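import Summits.BirchSwinnertonDyer.BirchSwinnertonDyer.Theorems.ResidualThetaTransportAtTwoThetaLayerLambdaCongruenceAtTwoCuspSpanConjugation
import Mathlib.Tactic.NormNum.LegendreSymbol
import HarnessLib

/-!
# Route `ResidualThetaTransportAtTwo`, crux Kan⁺ `ThetaLayerLambdaCongruenceAtTwo` (stmt-BirchSwinnertonDyer-20688), node (G′)_N:
# the per-element witness statement (W_N) of `cuspSpanTrace_of_gamma1_conj_witness` is UNSATISFIABLE at `N = 7`

Cell `bsd-wall`, width seat `bsd-wall-rtt-p3-w4` (g0). THEOREMS ONLY; `--supports stmt-BirchSwinnertonDyer-20688`; BSD is not proved by this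
and nothing about the node is refuted by this: (G′)_7 is TRUE (Theorem A, `cuspSpanEvenAtTwo_of_primePow`). What is recorded is a
correction to the docstring of `…CuspSpanConjugation.cuspSpanTrace_of_gamma1_conj_witness` (p626263, «(W_N) holds at every odd N ≤ 401 by
the (T_N) certificates»): the hypothesis (W_N) — «EVERY `γ ∈ Γ₁'(N)` has integers `t, m`, `k ≥ 1`, `ε = ±1` with
`d + tNb + m(c + tNa) = ε4^k`» — already fails at `N = 7` for `γ = (29 2; 14 1)`: a witness forces `ε = 1` (mod `7`) and
`(2 + 29t) ∣ 29·4^k − 1`, so `29` is a square modulo the odd number `|2 + 29t| ≥ 3`, whence the Jacobi symbol `(29 / |2+29t|) = +1`; but by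
reciprocity it equals `(|2+29t| / 29) = (±2 / 29) = −1`. So the hooks `cuspSpanTrace_of_gamma1_conj_witness` /
`forall_cuspSpanEvenAtTwo_of_forall_gamma1_conj_witness` are vacuous as typed; the correct arithmetic residue lets `γ` first move in its
parabolic orbit (`γ ↦ T^i γ`, `γ ↦ L_t γ`), as in `…CuspSpanArtinReduction` (w5) / `…CuspSpanArtinNamed` (this seat), where it is discharged
from Artin's conjecture for the base `2` in progressions. (For this `γ`, `T^{-3}γ⁻¹` has first column `(43, −14)` and the Artin prime
`q = 131` kills it.)

References: [IrelandRosen1990] Ch. 5 §2 (Jacobi reciprocity); [Rademacher1929] §1.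
-/

set_option autoImplicit false
set_option linter.dupNamespace false

noncomputable section

open scoped MatrixGroups NumberTheorySymbols

open CongruenceSubgroup

namespace Summit.BirchSwinnertonDyer.BirchSwinnertonDyer.Theorems.SignedMuAtTwo

/-- Arithmetic core: no integers `t, m`, `k ≥ 1` satisfy `1 + 14t + 7m(2 + 29t) = 4^k` — the number `g = 2 + 29t` would be an odd
divisor `≠ ±1` of `29·4^k − 1`, making `29` a square mod `|g|`, i.e. `(29 / |g|) = 1`, against `(29 / |g|) = (|g| / 29) = (±2 / 29) = −1`.
[cite: IrelandRosen1990, Ch. 5 §2 Prop. 5.2.2] -/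
theorem no_conj_witness_29_2_14_1 (t m : ℤ) (k : ℕ) (hk : 1 ≤ k) :
    (1 : ℤ) + t * 7 * 2 + m * (14 + t * 7 * 29) ≠ 4 ^ k := by
  intro h
  set g : ℤ := 2 + 29 * t with hg
  have hdvd : g ∣ 29 * 4 ^ k - 1 := ⟨14 + 203 * m, by rw [hg]; linear_combination (-29 : ℤ) * h⟩
  -- `g` is odd and `|g| ≠ 1`
  have hodd4 : ¬ (2 : ℤ) ∣ 29 * 4 ^ k - 1 := by
    intro h2
    have : (2 : ℤ) ∣ 29 * 4 ^ k := by
      obtain ⟨k', rfl⟩ := Nat.exists_eq_add_of_le' hk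
      exact ⟨29 * 2 * 4 ^ k', by ring⟩
    have h1 : (2 : ℤ) ∣ 1 := by simpa using dvd_sub this h2
    norm_num at h1
  have hgodd : ¬ (2 : ℤ) ∣ g := fun h2 ↦ hodd4 (h2.trans hdvd)
  set b := g.natAbs with hb
  have hb_odd : Odd b := by
    rw [Nat.odd_iff]
    have : g % 2 = 1 := by omega
    omega
  have hb1 : b ≠ 1 := by
    intro h1
    rcases Int.natAbs_eq g with h' | h' <;> rw [← hb, h1] at h' <;> omega
  have hb0 : b ≠ 0 := by
    rw [hb]
    intro h0
    exact hgodd ⟨0, by simp [Int.natAbs_eq_zero.mp h0]⟩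
  haveI : NeZero b := ⟨hb0⟩
  -- `29 * 4^k = 1` in `ZMod b`, so `29` is a square there
  have hbdvd : (b : ℤ) ∣ 29 * 4 ^ k - 1 := Int.natAbs_dvd.mpr hdvd
  have hz : ((29 * 4 ^ k - 1 : ℤ) : ZMod b) = 0 := (ZMod.intCast_zmod_eq_zero_iff_dvd _ b).mpr hbdvd
  push_cast at hz
  have h2b : Nat.Coprime 2 b := (Nat.Prime.coprime_iff_not_dvd Nat.prime_two).mpr fun h2 ↦ by
    apply hgodd
    rw [hb] at h2
    have h2' : ((2 : ℕ) : ℤ) ∣ (g.natAbs : ℤ) := Int.natCast_dvd_natCast.mpr h2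
    exact Int.dvd_natAbs.mp h2'
  set u : (ZMod b)ˣ := ZMod.unitOfCoprime 2 h2b with hu
  have hu2 : (u : ZMod b) = 2 := by rw [hu, ZMod.coe_unitOfCoprime]; norm_num
  have hsq : IsSquare ((29 : ℤ) : ZMod b) := by
    have h4 : (4 : ZMod b) ^ k = ((u ^ k * u ^ k : (ZMod b)ˣ) : ZMod b) := by
      push_cast; rw [hu2, ← mul_pow]; norm_num
    have h29 : ((29 : ℤ) : ZMod b) * 4 ^ k = 1 := by
      push_cast; linear_combination hz
    rw [h4] at h29
    -- `29 = (u^k u^k)⁻¹ = (u^k)⁻¹ (u^k)⁻¹`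
    have : ((29 : ℤ) : ZMod b) = ((u ^ k * u ^ k)⁻¹ : (ZMod b)ˣ) := by
      rw [← mul_one (((29 : ℤ) : ZMod b)), ← Units.mul_inv (u ^ k * u ^ k), ← mul_assoc, h29, one_mul]
    refine ⟨(((u ^ k)⁻¹ : (ZMod b)ˣ) : ZMod b), ?_⟩
    rw [this, ← Units.val_mul, mul_inv]
  -- hence the Jacobi symbol `(29 / b)` is `1`
  have hcop : Int.gcd 29 b = 1 := by
    have h1 : IsCoprime (29 : ℤ) (b : ℤ) := by
      obtain ⟨e, he⟩ := hbdvd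
      exact ⟨4 ^ k, -e, by linear_combination he⟩
    exact Int.isCoprime_iff_gcd_eq_one.mp h1
  have hJ1 : J(29 | b) = 1 := by
    rcases jacobiSym.eq_one_or_neg_one hcop with h1 | h1
    · exact h1
    · exact absurd hsq (ZMod.nonsquare_of_jacobiSym_eq_neg_one h1)
  -- but reciprocity gives `(29 / b) = (b / 29) = (±2 / 29) = -1`
  have hrec : J(29 | b) = J((b : ℤ) | 29) := jacobiSym.quadratic_reciprocity_one_mod_four (by norm_num) hb_odd
  have hbmod : (b : ℤ) % 29 = 2 ∨ (b : ℤ) % 29 = 27 := by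
    rcases Int.natAbs_eq g with h' | h'
    · left; rw [hb, ← h', hg]; omega
    · right
      have : (b : ℤ) = -g := by rw [hb]; omega
      rw [this, hg]; omega
  have e29 : ((29 : ℕ) : ℤ) = 29 := by norm_num
  have hJ2 : J((b : ℤ) | 29) = -1 := by
    rw [jacobiSym.mod_left, e29]
    rcases hbmod with h' | h' <;> rw [h'] <;> norm_num
  rw [hrec, hJ2] at hJ1
  norm_num at hJ1

/-- **(W_7) fails**: the element `γ = (29 2; 14 1) ∈ Γ₁'(7)` has no conjugation witness — the hypothesis of
`cuspSpanTrace_of_gamma1_conj_witness` (p626263) is unsatisfiable at `N = 7` (its conclusion (G″)_7 is true regardless, Theorem A).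
[cite: IrelandRosen1990, Ch. 5 §2 Prop. 5.2.2] -/
theorem not_forall_gamma1_conj_witness_seven :
    ¬ (∀ γ : Gamma0 7, γ ∈ Gamma1' 7 → ∃ (t m : ℤ) (k : ℕ) (ε : ℤ), 1 ≤ k ∧ ε.natAbs = 1 ∧
      (γ : SL(2, ℤ)) 1 1 + t * (7 : ℕ) * (γ : SL(2, ℤ)) 0 1 +
        m * ((γ : SL(2, ℤ)) 1 0 + t * (7 : ℕ) * (γ : SL(2, ℤ)) 0 0) = ε * 4 ^ k) := by
  intro H
  obtain ⟨γ, h00, h01, h10, h11⟩ :=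
    ThetaLayerLambdaCongruenceAtTwo.exists_gamma0_entries (N := 7) 29 2 14 1 (by norm_num) ⟨2, by norm_num⟩
  have hmem : γ ∈ Gamma1' 7 := by
    rw [Gamma1_mem']
    change ((((γ : SL(2, ℤ)) 1 1 : ℤ) : ZMod 7)) = 1
    rw [h11, Int.cast_one]
  obtain ⟨t, m, k, ε, hk, hε, h⟩ := H γ hmem
  rw [h00, h01, h10, h11] at h
  push_cast at h
  -- `ε = 1`: reduce mod 7
  have hε1 : ε = 1 := by
    rcases Int.natAbs_eq ε with h' | h' <;> rw [hε] at h'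
    · exact_mod_cast h'
    · exfalso
      rw [h'] at h
      push_cast at h
      have h7 : ((1 + t * 7 * 2 + m * (14 + t * 7 * 29) : ℤ) : ZMod 7) = ((-1 * 4 ^ k : ℤ) : ZMod 7) := by rw [h]
      push_cast at h7
      have hred : (7 : ZMod 7) = 0 := by decide
      have h14 : (14 : ZMod 7) = 0 := by decide
      rw [hred, h14] at h7
      simp only [mul_zero, zero_mul, add_zero] at h7
      -- `1 = -4^k` in `ZMod 7` is impossible (`4^3 = 1`)
      have hp : (4 : ZMod 7) ^ k = 4 ^ (k % 3) := by
        conv_lhs => rw [← Nat.div_add_mod k 3, pow_add, pow_mul]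
        rw [show (4 : ZMod 7) ^ 3 = 1 by decide, one_pow, one_mul]
      rw [hp] at h7
      have hk3 : k % 3 < 3 := Nat.mod_lt k (by norm_num)
      interval_cases (k % 3) <;> revert h7 <;> decide
  rw [hε1, one_mul] at h
  exact no_conj_witness_29_2_14_1 t m k hk h

end Summit.BirchSwinnertonDyer.BirchSwinnertonDyer.Theorems.SignedMuAtTwo

end
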